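import Literature.AlgebraicGeometry.ShimuraVarieties.UnitaryShimuraCurveRecord
import HarnessLib

/-!
# The sub-datum `φ : U(J⋆)(𝔸_f) ↪ U(H)(𝔸_f)` of the unitary Shimura curve is a CLOSED EMBEDDING

Topic `AlgebraicGeometry/ShimuraVarieties` (§3) over generic block-diagonal algebra in `NumberTheory/Automorphic` (§§1–2).
THEOREMS ONLY (no definition, no named fact, no instance, no `sorry`); imports ★ `UnitaryShimuraCurveRecord` only.

§1 (namespace `Literature.NumberTheory.Automorphic.UnitaryGroup`, generic commutative topological ring `S`; `T1Space S` where
closedness is claimed).  For the ★ block-diagonal homomorphisms of `UnitaryGroupDirectSum`: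
* `blockDiagGL_mem_iff` — `diag(g₁, g₂) ∈ U(σ, H₁ ⊕ H₂) ↔ g₁ ∈ U(σ, H₁) ∧ g₂ ∈ U(σ, H₂)` (converse of ★ `blockDiagGL_mem`);
* `mem_range_blockDiagGL_iff` — an invertible matrix is block-diagonal with invertible blocks iff its off-diagonal blocks
  vanish (the diagonal blocks of an invertible block-diagonal matrix are invertible: read `g g⁻¹ = g⁻¹ g = 1` blockwise);
* `isEmbedding_blockDiagGL`, `isClosed_range_blockDiagGL`, **`isClosedEmbedding_blockDiagGL`** —
  `GL_{n₁}(S) × GL_{n₂}(S) → GL_{n₁ ⊕ n₂}(S)` is a closed embedding (embedding: the block-extraction maps on `g` and `g⁻¹`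
  recover the defining `Units.embedProduct` coordinates; closed range: zero off-diagonal blocks);
* `isClosedEmbedding_reindexGL` (a homeomorphism, ★ `GLn.reindexEquiv`), **`isClosedEmbedding_blockDiagFin`** —
  `U(σ, J₁) × U(σ, J₂) → U(σ, J₁ ⊕ᶠ J₂)`; its range is `{u | (u : GL) ∈ range (reindexGL ∘ blockDiagGL)}` by
  `blockDiagGL_mem_iff`, so NO continuity of `σ` and NO closedness of `U(σ, J)` in `GL` is used.
§2 (same namespace, number-field carriers): **`isClosedEmbedding_finAdelicBlockDiag`** —
  `U(J₁)(𝔸_{F,f}) × U(J₂)(𝔸_{F,f}) → U(J₁ ⊕ᶠ J₂)(𝔸_{F,f})` (★ `UnitaryGroupDirectSumCarriersFinite`) is a closed embedding.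
§3 (namespace `Literature.AlgebraicGeometry.ShimuraVarieties.UnitaryCanonicalModel`): **`isClosedEmbedding_φGS`** — the pin's
  `φ = R_B ∘ blockdiag ∘ (·, 1) : U(J⋆)(𝔸_{L⁺,f}) →* U(H)(𝔸_{L⁺,f})` (★ `φGS`, `UnitaryShimuraCurveRecord` §5) is a closed
  embedding of topological groups; `φGS_injective`, `isClosed_range_φGS`.

WHY (cell hodgecm-mathlib, road (ii) «embedded-curve descent» of the GS-3 retirement, leaf R2-1): the closed-embedding
property of `φ` is the hypothesis `hφ` of ★ `Literature.Topology.Algebra.exists_isOpen_isCompact_subgroup_comap_eq`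
(`CompactOpenSubgroupTrace`: every compact open `K⋆ ≤ φ⁻¹(K₀)` is `φ⁻¹(K)` for a compact open `K ≤ K₀` — [Deligne1971TravauxShimura]
Prop. 1.15 / [Milne2005ShimuraVarieties] Thm. 5.16, the group-theoretic half) and gives the cofinality of the levels
`φ⁻¹(K₀ ∩ K_H(𝔫))` among the compact open subgroups of `U(J⋆)(𝔸_f)` used by the injectivity half.  In print this is the
standard fact that a closed immersion of linear algebraic groups induces a closed embedding on adelic points
([PlatonovRapinchuk1994] §5.1; [Deligne1971TravauxShimura] 1.15.3 uses it for `G'(𝐀_f) ↪ G(𝐀_f)`); here it is proved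
directly for the explicit block-diagonal map.  HC_CM is proved only modulo the 7 printed citations until rung 0 closes; this
file proves no cell binder.

## References
* [PlatonovRapinchuk1994] V. Platonov, A. Rapinchuk, *Algebraic Groups and Number Theory* (1994), §2.3 (unitary groups of
  hermitian forms, orthogonal sums), §5.1 (adelic points; closed subgroups go to closed subgroups).
* [Deligne1971TravauxShimura] P. Deligne, *Travaux de Shimura*, Sém. Bourbaki 389 (1971), Prop. 1.15 and 1.15.3, pp. 132–133.
* [Milne2005ShimuraVarieties] J. S. Milne, *Introduction to Shimura varieties* (2005), Thm. 5.16.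
* [BourbakiGT1] N. Bourbaki, *General Topology*, Ch. I §5 (embeddings, closed maps) and Ch. III §2 (subgroups of topological groups).
-/

set_option autoImplicit false

noncomputable section

open Topology NumberField IsDedekindDomain
open scoped Matrix

namespace Literature.NumberTheory.Automorphic.UnitaryGroup

/-! ### §1. Generic: `blockDiagGL`, `reindexGL`, `blockDiagFin` are closed embeddings -/

section BlockDiagTopology

variable {S : Type*} [CommRing S] {n₁ n₂ : Type*} [Fintype n₁] [Fintype n₂] [DecidableEq n₁] [DecidableEq n₂]

/-- **`diag(g₁, g₂) ∈ U(σ, H₁ ⊕ H₂) ↔ g₁ ∈ U(σ, H₁) ∧ g₂ ∈ U(σ, H₂)`** — the blocks of a unitary block-diagonal element are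
unitary (converse of `blockDiagGL_mem`: read `σ(g)ᵀ (H₁ ⊕ H₂) g = H₁ ⊕ H₂` blockwise). [cite: PlatonovRapinchuk1994, §2.3] -/
theorem blockDiagGL_mem_iff (σ : S →+* S) (H₁ : Matrix n₁ n₁ S) (H₂ : Matrix n₂ n₂ S) (g₁ : GL n₁ S) (g₂ : GL n₂ S) :
    blockDiagGL (g₁, g₂) ∈ unitaryGroupOfForm σ (Matrix.fromBlocks H₁ 0 0 H₂) ↔
      g₁ ∈ unitaryGroupOfForm σ H₁ ∧ g₂ ∈ unitaryGroupOfForm σ H₂ := by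
  refine ⟨fun h => ?_, fun h => blockDiagGL_mem σ h.1 h.2⟩
  rw [mem_unitaryGroupOfForm_iff, coe_blockDiagGL, Matrix.fromBlocks_map, Matrix.fromBlocks_transpose,
    Matrix.fromBlocks_multiply, Matrix.fromBlocks_multiply] at h
  simp only [Matrix.map_zero σ (map_zero σ), Matrix.transpose_zero, Matrix.mul_zero, Matrix.zero_mul, add_zero,
    zero_add] at h
  obtain ⟨h₁, -, -, h₂⟩ := Matrix.fromBlocks_inj.mp h
  exact ⟨mem_unitaryGroupOfForm_iff.mpr h₁, mem_unitaryGroupOfForm_iff.mpr h₂⟩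

/-- **Range of `blockDiagGL`**: an invertible matrix `g ∈ GL_{n₁ ⊕ n₂}(S)` is `diag(g₁, g₂)` with `gᵢ ∈ GL_{nᵢ}(S)` iff its
off-diagonal blocks vanish.  (⇐: then `g = diag(A, D)` and, reading `g g⁻¹ = 1 = g⁻¹ g` blockwise, the diagonal blocks
`A`, `D` are invertible with inverses the diagonal blocks of `g⁻¹`.) [cite: PlatonovRapinchuk1994, §2.3] -/
theorem mem_range_blockDiagGL_iff (g : GL (n₁ ⊕ n₂) S) :
    g ∈ Set.range (blockDiagGL : GL n₁ S × GL n₂ S → GL (n₁ ⊕ n₂) S) ↔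
      (g : Matrix (n₁ ⊕ n₂) (n₁ ⊕ n₂) S).toBlocks₁₂ = 0 ∧ (g : Matrix (n₁ ⊕ n₂) (n₁ ⊕ n₂) S).toBlocks₂₁ = 0 := by
  constructor
  · rintro ⟨p, rfl⟩
    exact ⟨rfl, rfl⟩
  · rintro ⟨h12, h21⟩
    have hg : (g : Matrix (n₁ ⊕ n₂) (n₁ ⊕ n₂) S) =
        Matrix.fromBlocks (g : Matrix (n₁ ⊕ n₂) (n₁ ⊕ n₂) S).toBlocks₁₁ 0 0 (g : Matrix (n₁ ⊕ n₂) (n₁ ⊕ n₂) S).toBlocks₂₂ := by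
      conv_lhs => rw [← Matrix.fromBlocks_toBlocks (g : Matrix (n₁ ⊕ n₂) (n₁ ⊕ n₂) S)]
      rw [h12, h21]
    have hg' : ((g⁻¹ : GL (n₁ ⊕ n₂) S) : Matrix (n₁ ⊕ n₂) (n₁ ⊕ n₂) S) =
        Matrix.fromBlocks ((g⁻¹ : GL (n₁ ⊕ n₂) S) : Matrix (n₁ ⊕ n₂) (n₁ ⊕ n₂) S).toBlocks₁₁ ((g⁻¹ : GL (n₁ ⊕ n₂) S) : Matrix (n₁ ⊕ n₂) (n₁ ⊕ n₂) S).toBlocks₁₂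
          ((g⁻¹ : GL (n₁ ⊕ n₂) S) : Matrix (n₁ ⊕ n₂) (n₁ ⊕ n₂) S).toBlocks₂₁ ((g⁻¹ : GL (n₁ ⊕ n₂) S) : Matrix (n₁ ⊕ n₂) (n₁ ⊕ n₂) S).toBlocks₂₂ :=
      (Matrix.fromBlocks_toBlocks _).symm
    have h1 : (g : Matrix (n₁ ⊕ n₂) (n₁ ⊕ n₂) S) * ((g⁻¹ : GL (n₁ ⊕ n₂) S) : Matrix (n₁ ⊕ n₂) (n₁ ⊕ n₂) S) = 1 := by
      rw [← Units.val_mul, mul_inv_cancel, Units.val_one]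
    have h2 : ((g⁻¹ : GL (n₁ ⊕ n₂) S) : Matrix (n₁ ⊕ n₂) (n₁ ⊕ n₂) S) * (g : Matrix (n₁ ⊕ n₂) (n₁ ⊕ n₂) S) = 1 := by
      rw [← Units.val_mul, inv_mul_cancel, Units.val_one]
    rw [hg, hg', Matrix.fromBlocks_multiply, ← Matrix.fromBlocks_one, Matrix.fromBlocks_inj] at h1 h2
    simp only [Matrix.zero_mul, Matrix.mul_zero, add_zero, zero_add] at h1 h2
    refine ⟨(⟨_, _, h1.1, h2.1⟩, ⟨_, _, h1.2.2.2, h2.2.2.2⟩), Units.ext ?_⟩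
    rw [coe_blockDiagGL]
    exact hg.symm

variable [TopologicalSpace S] [IsTopologicalRing S]

/-- **`blockDiagGL : GL_{n₁}(S) × GL_{n₂}(S) → GL_{n₁ ⊕ n₂}(S)` is a topological embedding** (topological ring `S`; the
topology of `GL` is Mathlib's unit-group topology induced by `g ↦ (g, g⁻¹)`).  Proof: composing with the continuous block
extractions `g ↦ ((g₁₁, (g⁻¹)₁₁), (g₂₂, (g⁻¹)₂₂))` recovers `embedProduct × embedProduct`, which induces the topology of the
source; so `blockDiagGL` is inducing (`IsInducing.of_comp`), and it is injective. [cite: BourbakiGT1, Ch. III §2 no. 1] -/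
theorem isEmbedding_blockDiagGL : IsEmbedding (blockDiagGL : GL n₁ S × GL n₂ S → GL (n₁ ⊕ n₂) S) := by
  refine ⟨?_, blockDiagGL_injective⟩
  let π : GL (n₁ ⊕ n₂) S → (Matrix n₁ n₁ S × (Matrix n₁ n₁ S)ᵐᵒᵖ) × (Matrix n₂ n₂ S × (Matrix n₂ n₂ S)ᵐᵒᵖ) :=
    fun g => (((g : Matrix (n₁ ⊕ n₂) (n₁ ⊕ n₂) S).toBlocks₁₁, MulOpposite.op (((g⁻¹ : GL (n₁ ⊕ n₂) S) : Matrix (n₁ ⊕ n₂) (n₁ ⊕ n₂) S).toBlocks₁₁)),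
      ((g : Matrix (n₁ ⊕ n₂) (n₁ ⊕ n₂) S).toBlocks₂₂, MulOpposite.op (((g⁻¹ : GL (n₁ ⊕ n₂) S) : Matrix (n₁ ⊕ n₂) (n₁ ⊕ n₂) S).toBlocks₂₂)))
  have hπ : Continuous π := by
    refine Continuous.prodMk (Continuous.prodMk ?_ ?_) (Continuous.prodMk ?_ ?_)
    · exact Units.continuous_val.matrix_submatrix Sum.inl Sum.inl
    · exact MulOpposite.continuous_op.comp (Units.continuous_coe_inv.matrix_submatrix Sum.inl Sum.inl)
    · exact Units.continuous_val.matrix_submatrix Sum.inr Sum.inr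
    · exact MulOpposite.continuous_op.comp (Units.continuous_coe_inv.matrix_submatrix Sum.inr Sum.inr)
  have hcomp : π ∘ (blockDiagGL : GL n₁ S × GL n₂ S → GL (n₁ ⊕ n₂) S) =
      Prod.map (Units.embedProduct (Matrix n₁ n₁ S)) (Units.embedProduct (Matrix n₂ n₂ S)) := by
    funext g
    rfl
  have hind : IsInducing (π ∘ (blockDiagGL : GL n₁ S × GL n₂ S → GL (n₁ ⊕ n₂) S)) := by
    rw [hcomp]
    exact Units.isInducing_embedProduct.prodMap Units.isInducing_embedProduct
  exact IsInducing.of_comp continuous_blockDiagGL hπ hind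

/-- **`blockDiagGL` has closed range** when `S` is `T₁`: the range is the zero set of the two continuous off-diagonal
block extractions (`mem_range_blockDiagGL_iff`). [cite: BourbakiGT1, Ch. III §2 no. 1] -/
theorem isClosed_range_blockDiagGL [T1Space S] :
    IsClosed (Set.range (blockDiagGL : GL n₁ S × GL n₂ S → GL (n₁ ⊕ n₂) S)) := by
  have h : Set.range (blockDiagGL : GL n₁ S × GL n₂ S → GL (n₁ ⊕ n₂) S) =
      (fun g : GL (n₁ ⊕ n₂) S =>
        ((g : Matrix (n₁ ⊕ n₂) (n₁ ⊕ n₂) S).toBlocks₁₂, (g : Matrix (n₁ ⊕ n₂) (n₁ ⊕ n₂) S).toBlocks₂₁)) ⁻¹'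
          {((0 : Matrix n₁ n₂ S), (0 : Matrix n₂ n₁ S))} := by
    ext g
    rw [mem_range_blockDiagGL_iff, Set.mem_preimage, Set.mem_singleton_iff, Prod.mk.injEq]
  rw [h]
  refine isClosed_singleton.preimage ?_
  exact (Units.continuous_val.matrix_submatrix Sum.inl Sum.inr).prodMk
    (Units.continuous_val.matrix_submatrix Sum.inr Sum.inl)

/-- **`blockDiagGL : GL_{n₁}(S) × GL_{n₂}(S) → GL_{n₁ ⊕ n₂}(S)` is a CLOSED embedding** (`T₁` topological ring `S`).
[cite: BourbakiGT1, Ch. III §2 no. 1] -/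
theorem isClosedEmbedding_blockDiagGL [T1Space S] :
    IsClosedEmbedding (blockDiagGL : GL n₁ S × GL n₂ S → GL (n₁ ⊕ n₂) S) :=
  ⟨isEmbedding_blockDiagGL, isClosed_range_blockDiagGL⟩

omit [IsTopologicalRing S] in
/-- **`reindexGL e : GL_m(S) → GL_n(S)` is a closed embedding** — indeed a homeomorphism (it agrees pointwise with the
★ `GLn.reindexEquiv e : GL_m(S) ≃ₜ* GL_n(S)`). [cite: BourbakiGT1, Ch. I §5 no. 1] -/
theorem isClosedEmbedding_reindexGL {m n : Type*} [Fintype m] [DecidableEq m] [Fintype n] [DecidableEq n] (e : m ≃ n) :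
    IsClosedEmbedding (reindexGL (S := S) e) := by
  have h : ⇑(reindexGL (S := S) e) = ⇑(GLn.reindexEquiv (R := S) e) :=
    funext fun g => Units.ext rfl
  rw [h]
  exact (GLn.reindexEquiv (R := S) e).toHomeomorph.isClosedEmbedding

/-- **`blockDiagFin σ J₁ J₂ : U(σ, J₁) × U(σ, J₂) → U(σ, J₁ ⊕ᶠ J₂)` is a CLOSED embedding** (`T₁` topological ring `S`;
nothing is assumed on `σ`).  Embedding: it is `reindexGL ∘ blockDiagGL` on underlying invertible matrices, restricted to
subspaces.  Closed range: `range = {u | (u : GL) ∈ range (reindexGL ∘ blockDiagGL)}` — if a unitary `u` is `diag(A, D)`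
with `A, D` invertible then `A ∈ U(σ, J₁)`, `D ∈ U(σ, J₂)` (`blockDiagGL_mem_iff`) — and that set is the preimage of a closed
set under the continuous inclusion `U(σ, J₁ ⊕ᶠ J₂) ↪ GL`. [cite: PlatonovRapinchuk1994, §2.3] [cite: BourbakiGT1, Ch. III §2 no. 1] -/
theorem isClosedEmbedding_blockDiagFin [T1Space S] {N₁ N₂ : ℕ} (σ : S →+* S) (J₁ : Matrix (Fin N₁) (Fin N₁) S)
    (J₂ : Matrix (Fin N₂) (Fin N₂) S) : IsClosedEmbedding (blockDiagFin σ J₁ J₂) := by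
  have hΦ : IsClosedEmbedding ((reindexGL (S := S) finSumFinEquiv) ∘
      (blockDiagGL : GL (Fin N₁) S × GL (Fin N₂) S → GL (Fin N₁ ⊕ Fin N₂) S)) :=
    (isClosedEmbedding_reindexGL _).comp isClosedEmbedding_blockDiagGL
  have hval : (Subtype.val : unitaryGroupOfForm σ (finSum N₁ N₂ J₁ J₂) → GL (Fin (N₁ + N₂)) S) ∘ blockDiagFin σ J₁ J₂ =
      ((reindexGL (S := S) finSumFinEquiv) ∘
        (blockDiagGL : GL (Fin N₁) S × GL (Fin N₂) S → GL (Fin N₁ ⊕ Fin N₂) S)) ∘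
        Prod.map (Subtype.val : unitaryGroupOfForm σ J₁ → GL (Fin N₁) S)
          (Subtype.val : unitaryGroupOfForm σ J₂ → GL (Fin N₂) S) :=
    rfl
  refine ⟨?_, ?_⟩
  · rw [← IsEmbedding.subtypeVal.of_comp_iff, hval]
    exact hΦ.isEmbedding.comp (IsEmbedding.subtypeVal.prodMap IsEmbedding.subtypeVal)
  · have hr : Set.range (blockDiagFin σ J₁ J₂) =
        (Subtype.val : unitaryGroupOfForm σ (finSum N₁ N₂ J₁ J₂) → GL (Fin (N₁ + N₂)) S) ⁻¹'
          Set.range ((reindexGL (S := S) finSumFinEquiv) ∘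
            (blockDiagGL : GL (Fin N₁) S × GL (Fin N₂) S → GL (Fin N₁ ⊕ Fin N₂) S)) := by
      ext u
      constructor
      · rintro ⟨g, rfl⟩
        exact ⟨((g.1 : GL (Fin N₁) S), (g.2 : GL (Fin N₂) S)), rfl⟩
      · rintro ⟨⟨A, D⟩, hAD⟩
        have hu : reindexGL (S := S) finSumFinEquiv (blockDiagGL (A, D)) ∈
            unitaryGroupOfForm σ (finSum N₁ N₂ J₁ J₂) := by
          have hu2 := u.2
          rw [← hAD] at hu2
          exact hu2
        have hmem : blockDiagGL (A, D) ∈ unitaryGroupOfForm σ (Matrix.fromBlocks J₁ 0 0 J₂) :=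
          (reindexGL_mem_iff σ finSumFinEquiv _ _).1 hu
        obtain ⟨hA, hD⟩ := (blockDiagGL_mem_iff σ J₁ J₂ A D).1 hmem
        exact ⟨(⟨A, hA⟩, ⟨D, hD⟩), Subtype.ext hAD⟩
    rw [hr]
    exact hΦ.isClosed_range.preimage continuous_subtype_val

end BlockDiagTopology

/-! ### §2. Finite-adelic carriers: `finAdelicBlockDiag` is a closed embedding -/

section FinAdelic

variable (F E : Type) [Field F] [NumberField F] [Field E] [NumberField E] [Algebra F E]
variable (c : E ≃ₐ[F] E) (M₁ M₂ : ℕ) (J₁ : Matrix (Fin M₁) (Fin M₁) E) (J₂ : Matrix (Fin M₂) (Fin M₂) E)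

omit [NumberField F] in
/-- **`finAdelicBlockDiag : U(J₁)(𝔸_{F,f}) × U(J₂)(𝔸_{F,f}) → U(J₁ ⊕ᶠ J₂)(𝔸_{F,f})` is a CLOSED embedding** of
topological groups (subspace topologies from `GL_M(𝔸_E^∞)`; `𝔸_E^∞` is Hausdorff): it is `blockDiagFin` followed by the
identity isomorphism `MulEquiv.subgroupCongr` of ★ `finAdelic_finSum`, a homeomorphism. [cite: PlatonovRapinchuk1994, §5.1] -/
theorem isClosedEmbedding_finAdelicBlockDiag : IsClosedEmbedding (finAdelicBlockDiag F E c M₁ M₂ J₁ J₂) := by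
  haveI : T2Space (FiniteAdeleRing (𝓞 E) E) := inferInstanceAs <| T2Space
    (RestrictedProduct (fun v : HeightOneSpectrum (𝓞 E) => v.adicCompletion E)
      (fun v => (v.adicCompletionIntegers E : Set (v.adicCompletion E))) Filter.cofinite)
  have hb := isClosedEmbedding_blockDiagFin (conjFiniteAdele F E c) (finiteAdelicForm E M₁ J₁) (finiteAdelicForm E M₂ J₂)
  -- the identity isomorphism of the two spellings of `U(J₁ ⊕ᶠ J₂)(𝔸_{F,f})`, as a homeomorphism
  let e : ↥(unitaryGroupOfForm (conjFiniteAdele F E c)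
        (finSum M₁ M₂ (finiteAdelicForm E M₁ J₁) (finiteAdelicForm E M₂ J₂))) ≃ₜ
      ↥(finAdelic F E c (M₁ + M₂) (finSum M₁ M₂ J₁ J₂)) :=
    { toEquiv := (MulEquiv.subgroupCongr (finAdelic_finSum F E c M₁ M₂ J₁ J₂).symm).toEquiv
      continuous_toFun := continuous_subtype_val.subtype_mk _
      continuous_invFun := continuous_subtype_val.subtype_mk _ }
  have hcomp : ⇑(finAdelicBlockDiag F E c M₁ M₂ J₁ J₂) =
      e ∘ blockDiagFin (conjFiniteAdele F E c) (finiteAdelicForm E M₁ J₁) (finiteAdelicForm E M₂ J₂) :=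
    rfl
  rw [hcomp]
  exact e.isClosedEmbedding.comp hb

end FinAdelic

end Literature.NumberTheory.Automorphic.UnitaryGroup

/-! ### §3. The pin's `φ : U(J⋆)(𝔸_{L⁺,f}) →* U(H)(𝔸_{L⁺,f})` is a closed embedding -/

namespace Literature.AlgebraicGeometry.ShimuraVarieties

namespace UnitaryCanonicalModel

open Literature.NumberTheory.Automorphic Literature.NumberTheory.Automorphic.UnitaryGroup

variable (L : Type) [Field L] [NumberField L] [IsCMField L] (Jstar : Matrix (Fin 2) (Fin 2) L)
variable (Jperp : Matrix (Fin 1) (Fin 1) L) (H : Matrix (Fin 3) (Fin 3) L) (B : GL (Fin 3) L) {a : L} (ha : a ≠ 0)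
  (hB : formCongr ((IsCMField.complexConj L : L ≃ₐ[↥(maximalRealSubfield L)] L) : L →+* L) B (a • H) =
    finSum 2 1 Jstar Jperp)

/-- **`φ = R_B ∘ blockdiag ∘ (·, 1) : U(J⋆)(𝔸_{L⁺,f}) →* U(H)(𝔸_{L⁺,f})` is a CLOSED EMBEDDING** of topological groups
(★ `φGS`; [Liu2021] Thm. 4.15's sub-datum `G⋆ ↪ G` on finite-adelic points): `u ↦ (u, 1)` is a closed embedding
(`U(J⊥)(𝔸_f)` is Hausdorff), `finAdelicBlockDiag` is one (`isClosedEmbedding_finAdelicBlockDiag`), and `R_B = finAdelicCongr`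
is an isomorphism of topological groups.  This is the hypothesis `hφ` of ★ `exists_isOpen_isCompact_subgroup_comap_eq`
(`CompactOpenSubgroupTrace`) at `φ := φGS`, i.e. the group-theoretic input of [Deligne1971TravauxShimura] Prop. 1.15 /
[Milne2005ShimuraVarieties] Thm. 5.16 for the curve-in-surface datum. [cite: PlatonovRapinchuk1994, §5.1]
[cite: Deligne1971TravauxShimura, 1.15.3 p. 133] -/
theorem isClosedEmbedding_φGS : IsClosedEmbedding (φGS L Jstar Jperp H B ha hB) := by
  haveI : T2Space (FiniteAdeleRing (𝓞 L) L) := inferInstanceAs <| T2Space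
    (RestrictedProduct (fun v : HeightOneSpectrum (𝓞 L) => v.adicCompletion L)
      (fun v => (v.adicCompletionIntegers L : Set (v.adicCompletion L))) Filter.cofinite)
  -- `u ↦ (u, 1)` is a closed embedding (its range is `snd ⁻¹' {1}`)
  have h1 : IsClosedEmbedding (fun u : ↥(finAdelic (↥(maximalRealSubfield L)) L (IsCMField.complexConj L) 2 Jstar) =>
      (u, (1 : ↥(finAdelic (↥(maximalRealSubfield L)) L (IsCMField.complexConj L) 1 Jperp)))) := by
    refine ⟨isEmbedding_prodMkLeft _, ?_⟩
    have hr : Set.range (fun u : ↥(finAdelic (↥(maximalRealSubfield L)) L (IsCMField.complexConj L) 2 Jstar) =>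
        (u, (1 : ↥(finAdelic (↥(maximalRealSubfield L)) L (IsCMField.complexConj L) 1 Jperp)))) =
        Prod.snd ⁻¹' {1} := by
      ext ⟨u, v⟩
      simp only [Set.mem_range, Prod.mk.injEq, Set.mem_preimage, Set.mem_singleton_iff]
      exact ⟨fun ⟨_, _, hv⟩ => hv.symm, fun hv => ⟨u, rfl, hv.symm⟩⟩
    rw [hr]
    exact isClosed_singleton.preimage continuous_snd
  have h2 := isClosedEmbedding_finAdelicBlockDiag (↥(maximalRealSubfield L)) L (IsCMField.complexConj L) 2 1 Jstar Jperp
  have h3 : IsClosedEmbedding (finAdelicCongr (↥(maximalRealSubfield L)) L (IsCMField.complexConj L) B ha hB) :=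
    (finAdelicCongr (↥(maximalRealSubfield L)) L (IsCMField.complexConj L) B ha hB).toHomeomorph.isClosedEmbedding
  exact h3.comp (h2.comp h1)

/-- `φGS` is injective. [cite: PlatonovRapinchuk1994, §5.1] -/
theorem φGS_injective : Function.Injective (φGS L Jstar Jperp H B ha hB) :=
  (isClosedEmbedding_φGS L Jstar Jperp H B ha hB).injective

/-- The image `φ(U(J⋆)(𝔸_{L⁺,f})) ⊆ U(H)(𝔸_{L⁺,f})` is closed. [cite: PlatonovRapinchuk1994, §5.1] -/
theorem isClosed_range_φGS : IsClosed (Set.range (φGS L Jstar Jperp H B ha hB)) :=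
  (isClosedEmbedding_φGS L Jstar Jperp H B ha hB).isClosed_range

end UnitaryCanonicalModel

end Literature.AlgebraicGeometry.ShimuraVarieties

end
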